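import Mathlib

/-! # HonestZwanzig / PositiveMemory — the tent cut-counting bound (line `Sketch`, stub B)

Support file for item stmt-AtomisticToContinuum-12694 (`PositiveMemory` of route `HonestZwanzig`,
sub-problem `FouriersLaw`), stub B of skeleton v5 of line Sketch.

On `N` sites `x = 0, …, N-1` the tent profile is `ξ x = min x (N-1-x)` and the bond increments
are `g b = ξ (b+1) - ξ b` for `b + 1 < N` (and `g (N-1) = 0`, a phantom index). These increments
take the values `+1` on the left half `L = {b : 2b+3 ≤ N}`, `-1` on the right half
`R = {b : N < 2b+2, b+1 < N}` and `0` on the (at most two) remaining indices. Hence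
`g b * g b' ≤ 1`, and for a nonnegative kernel `K` the cut weights `1 - g b * g b' ∈ [0, 2]` vanish
on `L × L` and on `R × R`; the cross pairs `L × R` at distance `z` number at most `z`, and the zero
rows / columns contribute at most `2 Σ_{z<N} K z` each. This gives the pure counting bound
`Σ_{b b'} (1 - g b g b') K |b - b'| ≤ 4 Σ_{z<N} z K z + 16 Σ_{z<N} K z`
consumed by the locality reduction of the skeleton. Pure finite combinatorics, Mathlib only.
-/

noncomputable section

open Finset

namespace Summit.AtomisticToContinuum.FouriersLaw.Theorems.HonestZwanzig.PositiveMemory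

/-- Throughout, `G` with hypothesis `hG` denotes the explicit values of the tent increments as a
function of the bond index `n`: `+1` on the left half `2n+3 ≤ N`, `-1` on the right half
`N < 2n+2, n+1 < N`, and `0` otherwise (the apex bond for even `N`, the phantom index `N-1`).
Trichotomy for these explicit increments: left half (`= 1`), right half (`= -1`), or zero. -/
theorem cutCount_G_cases {N : ℕ} (G : ℕ → ℝ)
    (hG : ∀ n, G n = if 2 * n + 3 ≤ N then 1 else if N < 2 * n + 2 ∧ n + 1 < N then -1 else 0)
    (n : ℕ) : (2 * n + 3 ≤ N ∧ G n = 1) ∨ ((N < 2 * n + 2 ∧ n + 1 < N) ∧ G n = -1) ∨ G n = 0 := by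
  rw [hG]
  split_ifs with h1 h2
  · exact Or.inl ⟨h1, rfl⟩
  · exact Or.inr (Or.inl ⟨h2, rfl⟩)
  · exact Or.inr (Or.inr rfl)

/-- A zero increment is neither in the left nor in the right half. -/
theorem cutCount_G_eq_zero {N : ℕ} (G : ℕ → ℝ)
    (hG : ∀ n, G n = if 2 * n + 3 ≤ N then 1 else if N < 2 * n + 2 ∧ n + 1 < N then -1 else 0)
    {n : ℕ} (h : G n = 0) : ¬ 2 * n + 3 ≤ N ∧ ¬ (N < 2 * n + 2 ∧ n + 1 < N) := by
  by_cases h1 : 2 * n + 3 ≤ N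
  · rw [hG, if_pos h1] at h
    exact absurd h one_ne_zero
  by_cases h2 : N < 2 * n + 2 ∧ n + 1 < N
  · rw [hG, if_neg h1, if_pos h2] at h
    norm_num at h
  exact ⟨h1, h2⟩

/-- The increments lie in `{-1, 0, 1}`, so pairwise products are at most `1`. -/
theorem cutCount_G_mul_le_one {N : ℕ} (G : ℕ → ℝ)
    (hG : ∀ n, G n = if 2 * n + 3 ≤ N then 1 else if N < 2 * n + 2 ∧ n + 1 < N then -1 else 0)
    (a c : ℕ) : G a * G c ≤ 1 := by
  rw [hG, hG]
  split_ifs <;> norm_num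

/-- Row bound: for a fixed index `b < N`, at most two indices `b' < N` lie at each distance, so
`Σ_{b'<N} K |b - b'| ≤ 2 Σ_{z<N} K z` for nonnegative `K`. -/
theorem cutCount_row_le (N b : ℕ) (hb : b < N) (K : ℕ → ℝ) (hK : ∀ z, 0 ≤ K z) :
    ∑ b' ∈ range N, K (b - b' + (b' - b)) ≤ 2 * ∑ z ∈ range N, K z := by
  rw [← Finset.sum_range_add_sum_Ico _ hb.le, two_mul]
  refine add_le_add ?_ ?_
  · calc ∑ b' ∈ range b, K (b - b' + (b' - b))
          = ∑ j ∈ range b, (fun i => K (i + 1)) (b - 1 - j) := by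
            refine Finset.sum_congr rfl (fun j hj => ?_)
            rw [mem_range] at hj
            show K _ = K _
            congr 1
            omega
      _ = ∑ j ∈ range b, K (j + 1) := Finset.sum_range_reflect (fun i => K (i + 1)) b
      _ ≤ ∑ j ∈ range (N - 1), K (j + 1) :=
            Finset.sum_le_sum_of_subset_of_nonneg (range_subset_range.2 (by omega))
              (fun j _ _ => hK _)
      _ ≤ ∑ j ∈ range (N - 1), K (j + 1) + K 0 := le_add_of_nonneg_right (hK 0)
      _ = ∑ z ∈ range (N - 1 + 1), K z := (Finset.sum_range_succ' K (N - 1)).symm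
      _ = ∑ z ∈ range N, K z := by rw [Nat.sub_add_cancel (by omega : 1 ≤ N)]
  · rw [Finset.sum_Ico_eq_sum_range]
    calc ∑ k ∈ range (N - b), K (b - (b + k) + (b + k - b))
          = ∑ k ∈ range (N - b), K k := by
            refine Finset.sum_congr rfl (fun k _ => ?_)
            congr 1
            omega
      _ ≤ ∑ z ∈ range N, K z :=
            Finset.sum_le_sum_of_subset_of_nonneg (range_subset_range.2 (Nat.sub_le N b))
              (fun j _ _ => hK _)

/-- Cross bound: the pairs `(b, b') ∈ L × R` at distance `z = b' - b` number at most `z`, so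
`Σ_{(b,b') ∈ L×R} K (b' - b) ≤ Σ_{z<N} z K z` for nonnegative `K`. -/
theorem cutCount_cross_le (N : ℕ) (K : ℕ → ℝ) (hK : ∀ z, 0 ≤ K z) :
    ∑ b ∈ range N, ∑ b' ∈ range N,
        (if 2 * b + 3 ≤ N ∧ (N < 2 * b' + 2 ∧ b' + 1 < N) then K (b' - b) else 0) ≤
      ∑ z ∈ range N, (z : ℝ) * K z := by
  -- reindex each row by the distance `k = b' - b`
  have hrow : ∀ b ∈ range N,
      ∑ b' ∈ range N, (if 2 * b + 3 ≤ N ∧ (N < 2 * b' + 2 ∧ b' + 1 < N) then K (b' - b) else 0) ≤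
        ∑ k ∈ range N,
          (if 2 * b + 3 ≤ N ∧ (N < 2 * (b + k) + 2 ∧ b + k + 1 < N) then K k else 0) := by
    intro b hb
    rw [mem_range] at hb
    rw [← Finset.sum_range_add_sum_Ico _ hb.le,
      Finset.sum_eq_zero (fun b' hb' => if_neg (fun h => by rw [mem_range] at hb'; omega)),
      zero_add, Finset.sum_Ico_eq_sum_range]
    calc ∑ k ∈ range (N - b),
          (if 2 * b + 3 ≤ N ∧ (N < 2 * (b + k) + 2 ∧ b + k + 1 < N) then K (b + k - b) else 0)
          = ∑ k ∈ range (N - b),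
              (if 2 * b + 3 ≤ N ∧ (N < 2 * (b + k) + 2 ∧ b + k + 1 < N) then K k else 0) := by
            simp only [Nat.add_sub_cancel_left]
      _ ≤ _ := Finset.sum_le_sum_of_subset_of_nonneg (range_subset_range.2 (Nat.sub_le N b))
            (fun k _ _ => by split_ifs; exacts [hK k, le_rfl])
  calc _ ≤ ∑ b ∈ range N, ∑ k ∈ range N,
          (if 2 * b + 3 ≤ N ∧ (N < 2 * (b + k) + 2 ∧ b + k + 1 < N) then K k else 0) :=
        Finset.sum_le_sum hrow
    _ = ∑ k ∈ range N, ∑ b ∈ range N,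
          (if 2 * b + 3 ≤ N ∧ (N < 2 * (b + k) + 2 ∧ b + k + 1 < N) then K k else 0) :=
        Finset.sum_comm
    _ ≤ ∑ z ∈ range N, (z : ℝ) * K z := by
        refine Finset.sum_le_sum (fun k _ => ?_)
        rw [← Finset.sum_filter, Finset.sum_const, nsmul_eq_mul]
        refine mul_le_mul_of_nonneg_right ?_ (hK k)
        -- the count: `b` ranges in `[N/2 - k, (N-1)/2)`, an interval of length `≤ k`
        have hcard : ((range N).filter
            (fun b => 2 * b + 3 ≤ N ∧ (N < 2 * (b + k) + 2 ∧ b + k + 1 < N))).card ≤ k := by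
          calc _ ≤ (Ico (N / 2 - k) ((N - 1) / 2)).card := by
                refine Finset.card_le_card (fun b hb => ?_)
                simp only [mem_filter, mem_range] at hb
                rw [mem_Ico]
                omega
            _ ≤ k := by rw [Nat.card_Ico]; omega
        exact_mod_cast hcard

/-- Zero rows: the indices with vanishing increment are at most two (`N/2 - 1` for even `N`, and the
phantom index `N - 1`), each row contributing at most `2 Σ_{z<N} K z`. -/
theorem cutCount_zero_le {N : ℕ} (G : ℕ → ℝ)
    (hG : ∀ n, G n = if 2 * n + 3 ≤ N then 1 else if N < 2 * n + 2 ∧ n + 1 < N then -1 else 0)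
    (K : ℕ → ℝ) (hK : ∀ z, 0 ≤ K z) :
    ∑ b ∈ range N, ∑ b' ∈ range N, (if G b = 0 then K (b - b' + (b' - b)) else 0) ≤
      4 * ∑ z ∈ range N, K z := by
  set S := ∑ z ∈ range N, K z with hS_def
  have hS : 0 ≤ S := Finset.sum_nonneg (fun z _ => hK z)
  have hcard : ((range N).filter (fun b => G b = 0)).card ≤ 2 := by
    calc _ ≤ ({N / 2 - 1, N - 1} : Finset ℕ).card := by
          refine Finset.card_le_card (fun b hb => ?_)
          rw [Finset.mem_filter, Finset.mem_range] at hb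
          have h := cutCount_G_eq_zero G hG hb.2
          simp only [Finset.mem_insert, Finset.mem_singleton]
          omega
      _ ≤ 2 := Finset.card_le_two
  calc ∑ b ∈ range N, ∑ b' ∈ range N, (if G b = 0 then K (b - b' + (b' - b)) else 0)
      = ∑ b ∈ range N, (if G b = 0 then ∑ b' ∈ range N, K (b - b' + (b' - b)) else 0) := by
        refine Finset.sum_congr rfl (fun b _ => ?_)
        split_ifs
        · rfl
        · exact Finset.sum_const_zero
    _ ≤ ∑ b ∈ range N, (if G b = 0 then 2 * S else 0) := by
        refine Finset.sum_le_sum (fun b hb => ?_)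
        split_ifs
        · exact cutCount_row_le N b (mem_range.1 hb) K hK
        · exact le_rfl
    _ = (((range N).filter (fun b => G b = 0)).card : ℝ) * (2 * S) := by
        rw [← Finset.sum_filter, Finset.sum_const, nsmul_eq_mul]
    _ ≤ 2 * (2 * S) := by
        refine mul_le_mul_of_nonneg_right ?_ (by positivity)
        exact_mod_cast hcard
    _ = 4 * S := by ring

/-- Pointwise domination of the cut weight `(1 - g b g b') K |b - b'|` by twice the two cross
indicators plus the two zero indicators (all against the nonnegative kernel). -/
theorem cutCount_pointwise {N : ℕ} (G : ℕ → ℝ)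
    (hG : ∀ n, G n = if 2 * n + 3 ≤ N then 1 else if N < 2 * n + 2 ∧ n + 1 < N then -1 else 0)
    (K : ℕ → ℝ) (hK : ∀ z, 0 ≤ K z) (b b' : ℕ) :
    (1 - G b * G b') * K (b - b' + (b' - b)) ≤
      2 * (if 2 * b + 3 ≤ N ∧ (N < 2 * b' + 2 ∧ b' + 1 < N) then K (b' - b) else 0) +
      2 * (if 2 * b' + 3 ≤ N ∧ (N < 2 * b + 2 ∧ b + 1 < N) then K (b - b') else 0) +
      ((if G b = 0 then K (b - b' + (b' - b)) else 0) +
        (if G b' = 0 then K (b' - b + (b - b')) else 0)) := by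
  have k0 := hK (b - b' + (b' - b))
  have n1 :
      (0 : ℝ) ≤ (if 2 * b + 3 ≤ N ∧ (N < 2 * b' + 2 ∧ b' + 1 < N) then K (b' - b) else 0) := by
    split_ifs; exacts [hK _, le_rfl]
  have n2 :
      (0 : ℝ) ≤ (if 2 * b' + 3 ≤ N ∧ (N < 2 * b + 2 ∧ b + 1 < N) then K (b - b') else 0) := by
    split_ifs; exacts [hK _, le_rfl]
  have n3 : (0 : ℝ) ≤ (if G b = 0 then K (b - b' + (b' - b)) else 0) := by
    split_ifs; exacts [hK _, le_rfl]
  have n4 : (0 : ℝ) ≤ (if G b' = 0 then K (b' - b + (b - b')) else 0) := by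
    split_ifs; exacts [hK _, le_rfl]
  by_cases gb0 : G b = 0
  · have e3 : (if G b = 0 then K (b - b' + (b' - b)) else 0) = K (b - b' + (b' - b)) :=
      if_pos gb0
    rw [show (1 - G b * G b') = 1 by rw [gb0]; ring]
    linarith
  by_cases gb0' : G b' = 0
  · have e4 : (if G b' = 0 then K (b' - b + (b - b')) else 0) = K (b - b' + (b' - b)) := by
      rw [if_pos gb0', add_comm]
    rw [show (1 - G b * G b') = 1 by rw [gb0']; ring]
    linarith
  rcases cutCount_G_cases G hG b with ⟨hb, gb⟩ | ⟨⟨hb1, hb2⟩, gb⟩ | gb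
  · rcases cutCount_G_cases G hG b' with ⟨hb', gb'⟩ | ⟨⟨hb1', hb2'⟩, gb'⟩ | gb'
    · rw [show (1 - G b * G b') = 0 by rw [gb, gb']; ring]
      linarith
    · have e1 : (if 2 * b + 3 ≤ N ∧ (N < 2 * b' + 2 ∧ b' + 1 < N) then K (b' - b) else 0) =
          K (b - b' + (b' - b)) := by
        rw [if_pos ⟨hb, hb1', hb2'⟩]
        congr 1
        omega
      rw [show (1 - G b * G b') = 2 by rw [gb, gb']; ring]
      linarith
    · exact absurd gb' gb0'
  · rcases cutCount_G_cases G hG b' with ⟨hb', gb'⟩ | ⟨⟨hb1', hb2'⟩, gb'⟩ | gb'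
    · have e2 : (if 2 * b' + 3 ≤ N ∧ (N < 2 * b + 2 ∧ b + 1 < N) then K (b - b') else 0) =
          K (b - b' + (b' - b)) := by
        rw [if_pos ⟨hb', hb1, hb2⟩]
        congr 1
        omega
      rw [show (1 - G b * G b') = 2 by rw [gb, gb']; ring]
      linarith
    · rw [show (1 - G b * G b') = 0 by rw [gb, gb']; ring]
      linarith
    · exact absurd gb' gb0'
  · exact absurd gb gb0

/-- The counting bound in `ℕ`-indexed form, for the explicit increments `G`. -/
theorem cutCount_nat {N : ℕ} (G : ℕ → ℝ)
    (hG : ∀ n, G n = if 2 * n + 3 ≤ N then 1 else if N < 2 * n + 2 ∧ n + 1 < N then -1 else 0)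
    (K : ℕ → ℝ) (hK : ∀ z, 0 ≤ K z) :
    ∑ b ∈ range N, ∑ b' ∈ range N, (1 - G b * G b') * K (b - b' + (b' - b)) ≤
      4 * ∑ z ∈ range N, (z : ℝ) * K z + 16 * ∑ z ∈ range N, K z := by
  have hS : 0 ≤ ∑ z ∈ range N, K z := Finset.sum_nonneg (fun z _ => hK z)
  have h1 := cutCount_cross_le N K hK
  have h2 : ∑ b ∈ range N, ∑ b' ∈ range N,
      (if 2 * b' + 3 ≤ N ∧ (N < 2 * b + 2 ∧ b + 1 < N) then K (b - b') else 0) ≤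
        ∑ z ∈ range N, (z : ℝ) * K z := by
    rw [Finset.sum_comm]
    exact cutCount_cross_le N K hK
  have h3 := cutCount_zero_le G hG K hK
  have h4 : ∑ b ∈ range N, ∑ b' ∈ range N,
      (if G b' = 0 then K (b' - b + (b - b')) else 0) ≤ 4 * ∑ z ∈ range N, K z := by
    rw [Finset.sum_comm]
    exact cutCount_zero_le G hG K hK
  calc _ ≤ ∑ b ∈ range N, ∑ b' ∈ range N,
          (2 * (if 2 * b + 3 ≤ N ∧ (N < 2 * b' + 2 ∧ b' + 1 < N) then K (b' - b) else 0) +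
          2 * (if 2 * b' + 3 ≤ N ∧ (N < 2 * b + 2 ∧ b + 1 < N) then K (b - b') else 0) +
          ((if G b = 0 then K (b - b' + (b' - b)) else 0) +
            (if G b' = 0 then K (b' - b + (b - b')) else 0))) :=
        Finset.sum_le_sum (fun b _ =>
          Finset.sum_le_sum (fun b' _ => cutCount_pointwise G hG K hK b b'))
    _ = 2 * ∑ b ∈ range N, ∑ b' ∈ range N,
            (if 2 * b + 3 ≤ N ∧ (N < 2 * b' + 2 ∧ b' + 1 < N) then K (b' - b) else 0) +
        2 * ∑ b ∈ range N, ∑ b' ∈ range N,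
            (if 2 * b' + 3 ≤ N ∧ (N < 2 * b + 2 ∧ b + 1 < N) then K (b - b') else 0) +
        (∑ b ∈ range N, ∑ b' ∈ range N,
            (if G b = 0 then K (b - b' + (b' - b)) else 0) +
          ∑ b ∈ range N, ∑ b' ∈ range N,
            (if G b' = 0 then K (b' - b + (b - b')) else 0)) := by
        simp only [Finset.sum_add_distrib, ← Finset.mul_sum]
    _ ≤ _ := by linarith

/-- **Tent cut-counting bound.** For the tent profile `ξ x = min x (N-1-x)` on `N ≥ 2` sites with
bond increments `g b = ξ (b+1) - ξ b` (`b + 1 < N`; the phantom index `b = N-1` has `g = 0`), the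
increments lie in `{-1, 0, 1}` (so `g b * g b' ≤ 1`), and for every nonnegative kernel `K` the cut
weights satisfy `Σ_{b b'} (1 - g b g b') K |b - b'| ≤ 4 Σ_{z<N} z K z + 16 Σ_{z<N} K z`: the weight
vanishes on same-side pairs, the cross pairs at distance `z` number at most `z` per orientation, and
the at most two zero rows and two zero columns contribute at most `2 Σ K` each (weight `≤ 2`). -/
theorem stub_cutCount (N : ℕ) (hN : 2 ≤ N) (K : ℕ → ℝ) (hK : ∀ z, 0 ≤ K z)
    (ξ : Fin N → ℝ) (hξ : ∀ x : Fin N, ξ x = ((min x.val (N - 1 - x.val) : ℕ) : ℝ))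
    (g : Fin N → ℝ) (hg : ∀ b : Fin N, g b = ∑ j : Fin N, if j.val = b.val + 1 then ξ j - ξ b else 0) :
    (∀ b b' : Fin N, g b * g b' ≤ 1) ∧
    ∑ b : Fin N, ∑ b' : Fin N, (1 - g b * g b') * K (b.val - b'.val + (b'.val - b.val)) ≤
      4 * ∑ z ∈ Finset.range N, (z : ℝ) * K z + 16 * ∑ z ∈ Finset.range N, K z := by
  have _ := hN
  -- the explicit values of the increments: `+1` on the left half, `-1` on the right half, else `0`
  obtain ⟨G, hG⟩ : ∃ G : ℕ → ℝ,
      ∀ n, G n = if 2 * n + 3 ≤ N then 1 else if N < 2 * n + 2 ∧ n + 1 < N then -1 else 0 :=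
    ⟨fun n => if 2 * n + 3 ≤ N then 1 else if N < 2 * n + 2 ∧ n + 1 < N then -1 else 0,
      fun _ => rfl⟩
  have hgv : ∀ b : Fin N, g b = G b.val := by
    intro b
    rw [hg, hG]
    by_cases hb : b.val + 1 < N
    · rw [Finset.sum_eq_single ⟨b.val + 1, hb⟩]
      · rw [if_pos rfl, hξ, hξ]
        dsimp only
        split_ifs with h1 h2
        · rw [min_eq_left (by omega), min_eq_left (by omega)]
          push_cast
          ring
        · rw [min_eq_right (by omega), min_eq_right (by omega),
            show N - 1 - b.val = N - 1 - (b.val + 1) + 1 by omega]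
          push_cast
          ring
        · rw [min_eq_right (by omega), min_eq_left (by omega),
            show N - 1 - (b.val + 1) = b.val by omega]
          ring
      · intro j _ hj
        exact if_neg (fun h => hj (Fin.ext h))
      · intro h
        exact absurd (Finset.mem_univ _) h
    · rw [Finset.sum_eq_zero (fun j _ => if_neg (by have := j.isLt; omega)),
        if_neg (by omega), if_neg (by omega)]
  refine ⟨fun b b' => ?_, ?_⟩
  · rw [hgv, hgv]
    exact cutCount_G_mul_le_one G hG _ _
  · have h1 : ∀ b : Fin N,
        ∑ b' : Fin N, (1 - G b.val * G b'.val) *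
            K (b.val - b'.val + (b'.val - b.val)) =
          ∑ b' ∈ range N, (1 - G b.val * G b') *
            K (b.val - b' + (b' - b.val)) := fun b =>
      Fin.sum_univ_eq_sum_range
        (fun b' => (1 - G b.val * G b') * K (b.val - b' + (b' - b.val))) N
    have h2 : ∑ b : Fin N, ∑ b' ∈ range N, (1 - G b.val * G b') *
            K (b.val - b' + (b' - b.val)) =
          ∑ b ∈ range N, ∑ b' ∈ range N, (1 - G b * G b') *
            K (b - b' + (b' - b)) :=
      Fin.sum_univ_eq_sum_range
        (fun b => ∑ b' ∈ range N, (1 - G b * G b') * K (b - b' + (b' - b))) N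
    simp only [hgv]
    rw [Finset.sum_congr rfl (fun b _ => h1 b), h2]
    exact cutCount_nat G hG K hK

end Summit.AtomisticToContinuum.FouriersLaw.Theorems.HonestZwanzig.PositiveMemory
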